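/-
Copyright: the b2b-balaban cell (near-miss cell 7), T⁴-continuum fan-out; row NE7b ROUND-2 swarm, seat
t4-ne7b-formalise-leaf-05 gen 2 (row S6g′(c) of `t4/b2b-balaban-t4-ne7b-p1/LEAVES-NE7b.md`, owner's ruling R-OWNER-22-12 (2)).
Released under the licence of the surrounding project.
-/
import Summits.QuantumFields.BalabanUV.T4Continuum.Support.HistorySiblingSymmetry

/-!
# Sibling symmetry, part 2: the FREE-ORBIT count — equal-shape parts are interchangeable labels (row S6g′(c))

Summits-side support leaf of the T⁴-continuum cell (rung (B)+1 on a FINITE torus only; NOT infinite volume, NOT the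
mass gap, NOT the Clay statement; NOT a proof of the spine estimate NE7b).  Row NE7b, route «COUNT»; row S6g′(c)
«per-(step, shape) symmetrisation», part 2 of `HistorySiblingSymmetry`.  [folklore] finite group actions over abstract
finite types; nothing is quoted from print, nothing printed is asserted, no `[cite:]` tag, no `Prop` fact of Bałaban's.

WHY.  The physical configurations of one join are the LABELLED forest-admissible configurations `c : I → Pos` of
part 1 modulo relabelling the parts WITHIN THEIR SHAPE CLASSES (`key : I → K`, key = the tagged shape tree of the
part): two labelled configurations describe the same set of regions iff they differ by a permutation `σ` of `I` with
`key ∘ σ = key`.  On configurations that place the parts of one class at DISTINCT positions (always the case for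
realised histories: distinct parts are disjoint regions) that group acts FREELY, so «labelled = physical × ∏_g k_g!»
EXACTLY (`orbitCount_mul_card_eq_card`: Burnside's lemma with empty fixed-point sets), and part 1's bound on the
labelled hull becomes the per-join input of `HistorySiblingMass.step_cost_le` with its symmetry credit `Σ_g log k_g!`:
**`orbitCount · ∏_g k_g! ≤ (Σ_j B j)^{#parts−1} · ∏_{i ≠ h} A i`** (`orbitCount_mul_prod_factorial_le`).

WHAT.  §1 `card_eq_card_orbits_mul_card` (free action of a finite group on a finite type).  §2 an invariant finset as
a `G`-set (`subAction`), its orbit number **`orbitCount`** (a natural number; no quotient type is exported to the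
consumer), `orbitCount_mul_card_eq_card` (free on the finset) and the consumer's injection principle
**`card_le_orbitCount`** (a family of members of the finset, pairwise NOT related by the group, has at most `orbitCount`
members — this is how a term-indexed reading map lands in the count).  §3 the relabelling group
**`keyPerms key ≤ Equiv.Perm I`** (`key ∘ σ = key`), `card_keyPerms = ∏_k (#key-fibre k)!` (Mathlib's
`DomMulAct.stabilizer_card`), its action on configurations `(σ • c) i = c (σ⁻¹ i)`, the fibre-injective configurations
`injSet key`, FREENESS on them (`eq_one_of_smul_eq`), and the invariance of `forestSet ∩ injSet` when `ok`∕`touch` read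
the parts through `key` and the host is alone in its class (`smul_mem_forestInj`).  §4 the END in `ℕ` and in `ℝ`.

HONEST SCOPE.  As part 1: abstract finite types only; the binding to tagged genealogies (key := shape tree of the
sub-structure, `injSet` ⇐ disjointness of realised regions) is the instantiation of rows (a)(b), NOT here.  NE7b NOT
proved.  HONEST DEPENDENCY (cell): continuum YM on T⁴ ⇐ BetaPertH ∧ nine spine estimates (0/9 proved); BetaPertH ⇐
(D1) ∧ (D4) ∧ CAP+tail.  This file changes none of it.
-/

open Finset MulAction
open Summit.QuantumFields.BalabanUV.T4Continuum.HistorySiblingSymmetry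

namespace Summit.QuantumFields.BalabanUV.T4Continuum.HistorySiblingOrbits

noncomputable section

/-! ## §1 Free actions: the set is the orbits times the group -/

section Free

variable (G X : Type*) [Group G] [MulAction G X] [Fintype G] [Fintype X]

open scoped Classical

/-- **A FREE ACTION OF A FINITE GROUP ON A FINITE TYPE: `#X = #orbits · |G|`** (Burnside's lemma, the fixed-point set of
every `g ≠ 1` being empty and that of `1` everything). [folklore] -/
theorem card_eq_card_orbits_mul_card (free : ∀ (g : G) (x : X), g • x = x → g = 1) :
    Fintype.card X = Fintype.card (orbitRel.Quotient G X) * Fintype.card G := by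
  rw [← MulAction.sum_card_fixedBy_eq_card_orbits_mul_card_group G X, Finset.sum_eq_single (1 : G)]
  · exact (Fintype.card_congr (Equiv.subtypeUnivEquiv fun x => by simp)).symm
  · intro g _ hg
    exact Fintype.card_eq_zero_iff.2 ⟨fun x => hg (free g x.1 (MulAction.mem_fixedBy.1 x.2))⟩
  · intro h1
    exact absurd (mem_univ _) h1

end Free

/-! ## §2 An invariant finset as a `G`-set; its orbit number -/

section OnFinset

variable {G Y : Type*} [Group G] [MulAction G Y]

/-- the action restricted to an invariant finset [folklore] -/
@[reducible] def subAction (A : Finset Y) (hA : ∀ (g : G) (y : Y), y ∈ A → g • y ∈ A) : MulAction G {y // y ∈ A} where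
  smul g y := ⟨g • y.1, hA g y.1 y.2⟩
  one_smul y := Subtype.ext (one_smul G y.1)
  mul_smul g g' y := Subtype.ext (mul_smul g g' y.1)

/-- **THE ORBIT NUMBER** of an invariant finset: the number of classes of its members under the group (a natural number;
the quotient type stays inside this file). [folklore] -/
def orbitCount (A : Finset Y) (hA : ∀ (g : G) (y : Y), y ∈ A → g • y ∈ A) : ℕ :=
  Nat.card (@orbitRel.Quotient G {y // y ∈ A} _ (subAction A hA))

/-- **FREE ON THE FINSET ⇒ `orbitCount · |G| = #A`.** [folklore] -/
theorem orbitCount_mul_card_eq_card [Fintype G] (A : Finset Y) (hA : ∀ (g : G) (y : Y), y ∈ A → g • y ∈ A)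
    (free : ∀ (g : G), ∀ y ∈ A, g • y = y → g = 1) : orbitCount A hA * Fintype.card G = A.card := by
  classical
  letI : MulAction G {y // y ∈ A} := subAction A hA
  have hfree : ∀ (g : G) (x : {y // y ∈ A}), g • x = x → g = 1 :=
    fun g x hx => free g x.1 x.2 (congrArg Subtype.val hx)
  have h := card_eq_card_orbits_mul_card G {y // y ∈ A} hfree
  rw [Fintype.card_coe] at h
  rw [orbitCount, Nat.card_eq_fintype_card, h]

/-- **THE CONSUMER'S INJECTION PRINCIPLE**: a finite family of members of `A` that are pairwise NOT related by the group
has at most `orbitCount A` members. [folklore] -/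
theorem card_le_orbitCount (A : Finset Y) (hA : ∀ (g : G) (y : Y), y ∈ A → g • y ∈ A) {T : Type*} (S : Finset T)
    (φ : T → Y) (hφ : ∀ t ∈ S, φ t ∈ A)
    (hsep : ∀ t ∈ S, ∀ t' ∈ S, (∃ g : G, g • φ t = φ t') → t = t') : S.card ≤ orbitCount A hA := by
  classical
  letI : MulAction G {y // y ∈ A} := subAction A hA
  let Ω := orbitRel.Quotient G {y // y ∈ A}
  haveI : Fintype Ω := Fintype.ofFinite Ω
  let ψ : {t // t ∈ S} → Ω := fun t => Quotient.mk _ ⟨φ t.1, hφ t.1 t.2⟩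
  have hinj : Function.Injective ψ := by
    intro t t' heq
    apply Subtype.ext
    refine hsep t.1 t.2 t'.1 t'.2 ?_
    -- equal classes: `⟨φ t, _⟩` lies in the orbit of `⟨φ t', _⟩`
    have hrel : (⟨φ t.1, hφ t.1 t.2⟩ : {y // y ∈ A}) ∈ orbit G (⟨φ t'.1, hφ t'.1 t'.2⟩ : {y // y ∈ A}) :=
      Quotient.exact heq
    obtain ⟨g, hg⟩ := mem_orbit_iff.1 hrel
    refine ⟨g⁻¹, ?_⟩
    have hval := congrArg Subtype.val hg
    change g • φ t'.1 = φ t.1 at hval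
    rw [← hval, inv_smul_smul]
  calc S.card = Fintype.card {t // t ∈ S} := (Fintype.card_coe S).symm
    _ ≤ Fintype.card Ω := Fintype.card_le_of_injective ψ hinj
    _ = orbitCount A hA := by rw [orbitCount, Nat.card_eq_fintype_card]

end OnFinset

/-! ## §3 The relabelling group of a shape key, its action on configurations, freeness, invariance -/

section KeyPerms

variable {I K : Type*} (key : I → K)

/-- **THE RELABELLING GROUP**: the permutations of the parts preserving the shape key. [folklore] -/
def keyPerms : Subgroup (Equiv.Perm I) where
  carrier := {σ | ∀ i, key (σ i) = key i}
  mul_mem' {σ τ} hσ hτ i := by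
    show key (σ (τ i)) = key i
    rw [hσ, hτ]
  one_mem' _ := rfl
  inv_mem' {σ} hσ i := by
    have h := hσ (σ.symm i)
    rw [Equiv.apply_symm_apply] at h
    exact h.symm

variable {key} in
/-- membership [folklore] -/
theorem mem_keyPerms {σ : Equiv.Perm I} : σ ∈ keyPerms key ↔ ∀ i, key (σ i) = key i := Iff.rfl

variable {key} in
/-- the inverse of a member preserves the key [folklore] -/
theorem key_symm_apply (σ : keyPerms key) (i : I) : key ((σ : Equiv.Perm I).symm i) = key i :=
  (keyPerms key).inv_mem σ.2 i

section Card

variable [Fintype I] [DecidableEq I] [Fintype K] [DecidableEq K]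

open scoped Classical

/-- **`|keyPerms key| = ∏_k (#key-fibre k)!`** (Mathlib's `DomMulAct.stabilizer_card`). [folklore] -/
theorem card_keyPerms : Fintype.card (keyPerms key) = ∏ k, (Fintype.card {i // key i = k}).factorial := by
  rw [← DomMulAct.stabilizer_card key]
  refine Fintype.card_congr (Equiv.subtypeEquivRight fun σ => ?_)
  simp only [funext_iff, Function.comp_apply]
  exact mem_keyPerms

end Card

/-- **THE ACTION ON CONFIGURATIONS**: relabel the parts, `(σ • c) i = c (σ⁻¹ i)`. [folklore] -/
instance relabelAction (Pos : Type*) : MulAction (keyPerms key) (I → Pos) where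
  smul σ c := fun i => c ((σ : Equiv.Perm I).symm i)
  one_smul c := rfl
  mul_smul σ τ c := by
    funext i
    show c (((σ : Equiv.Perm I) * (τ : Equiv.Perm I)).symm i) =
      c ((τ : Equiv.Perm I).symm ((σ : Equiv.Perm I).symm i))
    rw [Equiv.Perm.mul_def, Equiv.symm_trans_apply]

variable {key}

/-- the action, pointwise [folklore] -/
theorem smul_apply {Pos : Type*} (σ : keyPerms key) (c : I → Pos) (i : I) :
    (σ • c) i = c ((σ : Equiv.Perm I).symm i) := rfl

/-- the action is precomposition with the inverse permutation [folklore] -/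
theorem smul_eq_comp {Pos : Type*} (σ : keyPerms key) (c : I → Pos) :
    σ • c = c ∘ ⇑(σ : Equiv.Perm I).symm := rfl

/-- a configuration is FIBRE-INJECTIVE if it places the parts of one shape class at distinct positions [folklore] -/
def InjOnFibres {Pos : Type*} (key : I → K) (c : I → Pos) : Prop :=
  ∀ i j, key i = key j → c i = c j → i = j

/-- **FREENESS**: a relabelling fixing a fibre-injective configuration is the identity. [folklore] -/
theorem eq_one_of_smul_eq {Pos : Type*} (σ : keyPerms key) {c : I → Pos} (hc : InjOnFibres key c)
    (h : σ • c = c) : σ = 1 := by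
  have hfix : ∀ i, (σ : Equiv.Perm I).symm i = i := fun i =>
    hc _ _ (key_symm_apply σ i) (by rw [← smul_apply σ c i, h])
  apply Subtype.ext
  ext i
  have := congrArg (σ : Equiv.Perm I) (hfix i)
  rw [Equiv.apply_symm_apply] at this
  exact this.symm

/-- fibre-injectivity is invariant [folklore] -/
theorem injOnFibres_smul {Pos : Type*} (σ : keyPerms key) {c : I → Pos} (hc : InjOnFibres key c) :
    InjOnFibres key (σ • c) := by
  intro i j hk heq
  rw [smul_apply, smul_apply] at heq
  have h := hc _ _ (by rw [key_symm_apply σ i, key_symm_apply σ j, hk]) heq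
  exact (σ : Equiv.Perm I).symm.injective h

section Invariance

variable [Fintype I] [DecidableEq I] {Pos : Type*} [Fintype Pos] [DecidableEq Pos]
variable {ok : I → Pos → Prop} {touch : I → Pos → I → Pos → Prop} {h : I}

open scoped Classical

/-- the fibre-injective configurations [folklore] -/
def injSet (key : I → K) : Finset (I → Pos) := univ.filter fun c => InjOnFibres key c

/-- the forest-admissible, fibre-injective configurations (host pinned) [folklore] -/
def forestInj (ok : I → Pos → Prop) (touch : I → Pos → I → Pos → Prop) (h : I) (p₀ : Pos) (key : I → K) :
    Finset (I → Pos) :=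
  forestSet ok touch h p₀ ∩ injSet key

/-- **INVARIANCE**: if the host is alone in its class and `ok`∕`touch` read the parts through `key`, the relabelling
group preserves `forestInj`. [folklore] -/
theorem smul_mem_forestInj (hkey : ∀ i, key i = key h → i = h) (hok : ∀ i j, key i = key j → ∀ p, (ok i p ↔ ok j p))
    (ht : ∀ i i' j j', key i = key i' → key j = key j' → ∀ p q, (touch i p j q ↔ touch i' p j' q)) (p₀ : Pos)
    (σ : keyPerms key) (c : I → Pos) (hc : c ∈ forestInj ok touch h p₀ key) : σ • c ∈ forestInj ok touch h p₀ key := by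
  rw [forestInj, mem_inter] at hc ⊢
  obtain ⟨hcF, hcI⟩ := hc
  refine ⟨?_, ?_⟩
  · rw [smul_eq_comp]
    refine (mem_forestSet_comp_perm (σ : Equiv.Perm I).symm ?_ (fun i p => ?_) (fun i p j q => ?_) p₀ c).2 hcF
    · exact hkey _ (key_symm_apply σ h)
    · exact hok _ _ (key_symm_apply σ i) p
    · exact ht _ _ _ _ (key_symm_apply σ i) (key_symm_apply σ j) p q
  · simp only [injSet, mem_filter, mem_univ, true_and] at hcI ⊢
    exact injOnFibres_smul σ hcI

/-- freeness on `forestInj` [folklore] -/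
theorem free_on_forestInj (p₀ : Pos) (σ : keyPerms key) (c : I → Pos) (hc : c ∈ forestInj ok touch h p₀ key)
    (hfix : σ • c = c) : σ = 1 := by
  rw [forestInj, mem_inter] at hc
  have hcI : InjOnFibres key c := by simpa [injSet] using hc.2
  exact eq_one_of_smul_eq σ hcI hfix

end Invariance

end KeyPerms

/-! ## §4 The END: physical configurations of a join times `∏ k_g!` are at most the forest bound -/

section End

variable {I K Pos : Type*} [Fintype I] [DecidableEq I] [Fintype K] [DecidableEq K] [Fintype Pos] [DecidableEq Pos]
variable {key : I → K} {ok : I → Pos → Prop} {touch : I → Pos → I → Pos → Prop} {h : I}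

open scoped Classical

/-- **THE ORBIT NUMBER OF A JOIN** (physical configurations: forest-admissible, fibre-injective, host pinned, modulo
relabelling within shape classes). [folklore] -/
def joinCount (hkey : ∀ i, key i = key h → i = h) (hok : ∀ i j, key i = key j → ∀ p, (ok i p ↔ ok j p))
    (ht : ∀ i i' j j', key i = key i' → key j = key j' → ∀ p q, (touch i p j q ↔ touch i' p j' q)) (p₀ : Pos) : ℕ :=
  orbitCount (G := keyPerms key) (forestInj ok touch h p₀ key) (smul_mem_forestInj hkey hok ht p₀)

/-- **`joinCount · ∏_k (#fibre k)! = #forestInj`** (the relabelling action is free on `forestInj`). [folklore] -/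
theorem joinCount_mul_prod_factorial_eq (hkey : ∀ i, key i = key h → i = h)
    (hok : ∀ i j, key i = key j → ∀ p, (ok i p ↔ ok j p))
    (ht : ∀ i i' j j', key i = key i' → key j = key j' → ∀ p q, (touch i p j q ↔ touch i' p j' q)) (p₀ : Pos) :
    joinCount hkey hok ht p₀ * ∏ k, (Fintype.card {i // key i = k}).factorial =
      (forestInj ok touch h p₀ key).card := by
  rw [← card_keyPerms key, joinCount]
  exact orbitCount_mul_card_eq_card _ _ fun σ c hc hfix => free_on_forestInj p₀ σ c hc hfix

/-- **THE END, NATURAL NUMBERS**: `joinCount · ∏_k (#fibre k)! ≤ ∏_{i ≠ h} Σ_j N i j` from the one-edge slot bound.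
[folklore] -/
theorem joinCount_mul_prod_factorial_le (hkey : ∀ i, key i = key h → i = h)
    (hok : ∀ i j, key i = key j → ∀ p, (ok i p ↔ ok j p))
    (ht : ∀ i i' j j', key i = key i' → key j = key j' → ∀ p q, (touch i p j q ↔ touch i' p j' q)) (p₀ : Pos)
    (N : I → I → ℕ) (hN : ∀ i, i ≠ h → ∀ j q, (univ.filter fun p : Pos => ok i p ∧ touch i p j q).card ≤ N i j) :
    joinCount hkey hok ht p₀ * ∏ k, (Fintype.card {i // key i = k}).factorial ≤ ∏ i : {i // i ≠ h}, ∑ j, N i.1 j := by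
  rw [joinCount_mul_prod_factorial_eq]
  exact (card_le_card inter_subset_left).trans (card_forestSet_le N hN)

/-- **THE END, REAL PRODUCT FORM**: `joinCount · ∏_k (#fibre k)! ≤ (Σ_j B j)^{#parts − 1} · ∏_{i ≠ h} A i` under
`N i j ≤ A i · B j` — the per-join input of `HistorySiblingMass.step_cost_le` (cost `(r−1)·log S + Σ_i log A i`, credit
`Σ_k log (#fibre k)!`). [folklore] -/
theorem joinCount_mul_prod_factorial_le_pow_mul (hkey : ∀ i, key i = key h → i = h)
    (hok : ∀ i j, key i = key j → ∀ p, (ok i p ↔ ok j p))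
    (ht : ∀ i i' j j', key i = key i' → key j = key j' → ∀ p q, (touch i p j q ↔ touch i' p j' q)) (p₀ : Pos)
    (N : I → I → ℕ) (hN : ∀ i, i ≠ h → ∀ j q, (univ.filter fun p : Pos => ok i p ∧ touch i p j q).card ≤ N i j)
    (A B : I → ℝ) (hAB : ∀ i, i ≠ h → ∀ j, (N i j : ℝ) ≤ A i * B j) :
    (joinCount hkey hok ht p₀ : ℝ) * ∏ k, ((Fintype.card {i // key i = k}).factorial : ℝ) ≤
      (∑ j, B j) ^ (Fintype.card I - 1) * ∏ i : {i // i ≠ h}, A i.1 := by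
  have h1 : ((joinCount hkey hok ht p₀ * ∏ k, (Fintype.card {i // key i = k}).factorial : ℕ) : ℝ) ≤
      ((forestSet ok touch h p₀).card : ℝ) := by
    rw [joinCount_mul_prod_factorial_eq]
    exact_mod_cast card_le_card (inter_subset_left (s₂ := injSet (Pos := Pos) key))
  have h2 := card_forestSet_le_pow_mul ok touch h p₀ N hN A B hAB
  push_cast at h1
  exact h1.trans h2

/-- **… AND THE CONSUMER'S FORM**: any finite family `φ` of forest-admissible, fibre-injective configurations (host
pinned) indexed by `S`, pairwise NOT relabellings of each other, has `#S · ∏_k (#fibre k)! ≤ (Σ_j B j)^{#parts−1}·∏ A i`.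
[folklore] -/
theorem card_mul_prod_factorial_le_pow_mul (hkey : ∀ i, key i = key h → i = h)
    (hok : ∀ i j, key i = key j → ∀ p, (ok i p ↔ ok j p))
    (ht : ∀ i i' j j', key i = key i' → key j = key j' → ∀ p q, (touch i p j q ↔ touch i' p j' q)) (p₀ : Pos)
    (N : I → I → ℕ) (hN : ∀ i, i ≠ h → ∀ j q, (univ.filter fun p : Pos => ok i p ∧ touch i p j q).card ≤ N i j)
    (A B : I → ℝ) (hAB : ∀ i, i ≠ h → ∀ j, (N i j : ℝ) ≤ A i * B j) {T : Type*} (S : Finset T) (φ : T → I → Pos)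
    (hφ : ∀ t ∈ S, φ t ∈ forestInj ok touch h p₀ key)
    (hsep : ∀ t ∈ S, ∀ t' ∈ S, (∃ σ : keyPerms key, σ • φ t = φ t') → t = t') :
    (S.card : ℝ) * ∏ k, ((Fintype.card {i // key i = k}).factorial : ℝ) ≤
      (∑ j, B j) ^ (Fintype.card I - 1) * ∏ i : {i // i ≠ h}, A i.1 := by
  have hS : S.card ≤ joinCount hkey hok ht p₀ := card_le_orbitCount _ _ S φ hφ hsep
  have hF : (0 : ℝ) ≤ ∏ k, ((Fintype.card {i // key i = k}).factorial : ℝ) :=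
    prod_nonneg fun _ _ => Nat.cast_nonneg _
  exact (mul_le_mul_of_nonneg_right (by exact_mod_cast hS) hF).trans
    (joinCount_mul_prod_factorial_le_pow_mul hkey hok ht p₀ N hN A B hAB)

end End

end

end Summit.QuantumFields.BalabanUV.T4Continuum.HistorySiblingOrbits
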